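import Literature.Computability.Complexity.PolynomialEntropyApproximationDegOne
import Literature.Computability.Complexity.PolynomialEntropyApproximationAffine
import Literature.Computability.Complexity.GaussRankFP
import Literature.Computability.Complexity.LengthCompare

/-!
# PneNP / SzkEntropy — crux `PeaThreeNotInP` (stmt-PneNP-10776), negative side: the degree-1 rung is in `P`

Route `PneNP/SzkEntropy`, crux X = `PeaThreeNotInP` (`PEA 3 ∉ PromiseP`).  NEGATIVE LEMMA (refutation of
a natural strengthening of X, no Theses decl asserted): the strengthening "`PEA_d ∉ PromiseP` for
every `d ≥ 1`" is FALSE —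

* **`PEA_one_mem_PromiseP : PEA 1 ∈ PromiseP`.**  Entropy approximation for sparse AFFINE maps over
  `F₂` is decided in deterministic polynomial time inside the tree's machine model (Mathlib `FinTM2`
  via the typed algebra `CodeFP`): read `(n, P, k)`, test the syntactic degree bound, compute the
  `F₂`-rank of the linear part restricted to the occurring variables by the list Gaussian
  elimination `GaussRank.lrank` (certified polynomial time: `GaussRank.codeFP_lrank`), accept iff
  `k + 1 ≤ rank`.  Correctness: `H(P(U_n)) = rank` (`PolyMapF2.entropy_eq_rank_of_degLE_one`,
  `PEADegOne.rank_untyped_eq`).  This is the polynomial-time certificate announced as "the sequel"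
  in `PolynomialEntropyApproximationDegOne.lean` (`codeFP_decideFn`).
* `PEA_one_promise_total` — at degree `1` the entropy is an INTEGER, so every degree-`≤ 1` instance
  is a yes- or a no-instance: the gap promise only starts to matter at degree `2`.
* `two_le_of_PEA_not_mem_PromiseP'` — consequently any degree witnessing hardness of entropy
  approximation is `≥ 2` (sharpens `one_le_of_PEA_not_mem_PromiseP` of
  `SzkEntropyPeaThreeNotInPDegreeDial.lean`; with `PEA_zero_mem_PromiseP` there): along the route's
  degree dial, X can only come from `d = 2` (crux `PeaTwoMemBPP`, open) or `d = 3` (X itself).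

References: Z. Dvir, D. Gutfreund, G. N. Rothblum, S. Vadhan, *On approximating the entropy of
polynomial mappings*, ICS 2011 (ECCC TR10-160), §1 p. 1 ("for linear maps the entropy is given by the
rank, computable in polynomial time"), §3 p. 6; J. von zur Gathen, J. Gerhard, *Modern Computer
Algebra*, 3rd ed., §12.1; S. Arora, B. Barak, *Computational Complexity*, CUP 2009, §1.3, Def. 1.13.
-/

namespace Summit.PneNP.PneNP.Theorems.PeaThreeNotInP.Negative

set_option linter.dupNamespace false -- `Summit.PneNP.PneNP.…`: summit = sub-problem name (D-0017 single-conjunct layout)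

open Literature.Computability.Complexity _root_.Computability Polynomial CodeFP PEADegOne

/-! ### The `CodeFP` certificate of the degree-1 procedure -/

/-- Context-free `all` over raw lists. [AroraBarak2009, §1.3] -/
theorem all₀ {α : Type} {eα : α → List Bool} {p : α → Bool} (hp : CodeFP eα bitE p) :
    CodeFP (rawE eα) bitE (fun l => l.all p) :=
  ((all (σ := Unit) (eσ := fun _ => []) (hp.comp (snd _ eα))).comp
    ((const (rawE eα) ()).pair (CodeFP.id (rawE eα)))).congr fun _ => rfl

/-- The syntactic degree test `degOK` on codes. [AroraBarak2009, §1.3] -/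
theorem codeFP_degOK : CodeFP (rawE (rawE (rawE natE))) bitE degOK :=
  (all₀ (all₀ (natLe.comp ((natLength natE).pair (const _ 1))))).congr fun _ => rfl

/-- `vars` (all variable occurrences, `P.flatten.flatten`) on codes. [AroraBarak2009, §1.3] -/
theorem codeFP_vars : CodeFP (rawE (rawE (rawE natE))) (rawE natE) vars :=
  ((flatten natE).comp (flatten (rawE natE))).congr fun _ => rfl

/-- The counting fold: `foldl (fun k μ => if μ == [v] then k + 1 else k) k₀ = k₀ + count [v]`. [folklore] -/
theorem foldl_countStep (v : ℕ) (l : List (List ℕ)) (k₀ : ℕ) :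
    l.foldl (fun k μ => if μ == [v] then k + 1 else k) k₀ = k₀ + l.count [v] := by
  induction l generalizing k₀ with
  | nil => simp
  | cons μ l ih =>
    rw [List.foldl_cons, ih, List.count_cons]
    by_cases h : (μ == [v]) = true
    · simp [h]; omega
    · simp [h]

/-- `(v, p) ↦ #{occurrences of the monomial [v] in p}` on codes (a fold with a counter).
[AroraBarak2009, §1.3] -/
theorem codeFP_countSingleton :
    CodeFP (pairE natE (rawE (rawE natE))) natE (fun q => q.2.count [q.1]) := by
  have hcond : CodeFP (pairE natE (pairE (rawE natE) natE)) bitE (fun t => t.2.1 == [t.1]) :=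
    (beq (rawE_injective natE_injective)).comp
      ((snd _ _).fst'.pair ((rawSingleton natE).comp (fst _ _)))
  have hacc : CodeFP (pairE natE (pairE (rawE natE) natE)) natE (fun t => t.2.2) := (snd _ _).snd'
  have hstep : CodeFP (pairE natE (pairE (rawE natE) natE)) natE
      (fun t => if t.2.1 == [t.1] then t.2.2 + 1 else t.2.2) :=
    hcond.ite (natAdd.comp (hacc.pair (const _ 1))) hacc
  have h := foldl (σ := ℕ) (α := List ℕ) (β := ℕ) (eσ := natE) (eα := rawE natE) (eβ := natE)
    (step := fun v μ k => if μ == [v] then k + 1 else k) (init := fun _ => 0)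
    hstep (const natE 0) X (fun v l₁ l₂ => by
      rw [foldl_countStep, Nat.zero_add, eval_X, pairE_apply, length_boolPair]
      calc (natE (l₁.count [v])).length ≤ l₁.count [v] := length_natE_le _
        _ ≤ l₁.length := List.count_le_length
        _ ≤ (l₁ ++ l₂).length := by simp
        _ ≤ (rawE (rawE natE) (l₁ ++ l₂)).length := length_le_length_rawE _ _
        _ ≤ _ := by dsimp only; omega)
  exact h.congr fun q => by rw [foldl_countStep, Nat.zero_add]

/-- `(p, v) ↦ (#{[v] in p} mod 2 : F₂)` on codes. [AroraBarak2009, §1.3] -/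
theorem codeFP_coeff :
    CodeFP (pairE (rawE (rawE natE)) natE) (GaussRank.zmodE 2)
      (fun q => ((q.1.count [q.2] : ℕ) : ZMod 2)) :=
  ((GaussRank.zmodOfNat (p := 2)).comp (codeFP_countSingleton.comp ((snd _ _).pair (fst _ _)))).congr
    fun _ => rfl

/-- `rows` (the parity matrix restricted to the occurring variables) on codes: two nested maps with
the list of occurring variables as context. [AroraBarak2009, §1.3] -/
theorem codeFP_rows : CodeFP (rawE (rawE (rawE natE))) (rawE (GaussRank.rowE 2)) rows := by
  have h1 : CodeFP (pairE (rawE (rawE natE)) (rawE natE)) (rawE (GaussRank.zmodE 2))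
      (fun q => q.2.map fun v => ((q.1.count [v] : ℕ) : ZMod 2)) := map codeFP_coeff
  have h2 : CodeFP (pairE (rawE natE) (rawE (rawE natE))) (rawE (GaussRank.zmodE 2))
      (fun q => q.1.map fun v => ((q.2.count [v] : ℕ) : ZMod 2)) :=
    (h1.comp ((snd _ _).pair (fst _ _))).congr fun _ => rfl
  have h3 : CodeFP (pairE (rawE natE) (rawE (rawE (rawE natE)))) (rawE (rawE (GaussRank.zmodE 2)))
      (fun q => q.2.map fun p => q.1.map fun v => ((p.count [v] : ℕ) : ZMod 2)) := map h2
  exact (h3.comp (codeFP_vars.pair (CodeFP.id _))).congr fun _ => rfl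

/-- `rank` (list Gaussian elimination over `F₂` on the restricted rows) on codes.
[vonzurGathenGerhard2013, §12.1; AroraBarak2009, §1.3] -/
theorem codeFP_rank : CodeFP (rawE (rawE (rawE natE))) natE rank :=
  ((GaussRank.codeFP_lrank (p := 2)).comp (((ulength natE).comp codeFP_vars).pair codeFP_rows)).congr
    fun _ => rfl

/-- **The degree-1 decision procedure `PEADegOne.decideFn` is computed on instance codes by a
polynomial-time string function.** [DvirGutfreundRothblumVadhan2010, §1 p. 1; AroraBarak2009, §1.3] -/
theorem codeFP_decideFn : CodeFP PEAInst.untypedCode bitE decideFn := by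
  have h1 : CodeFP (listE (listE (listE natE))) (rawE (listE (listE natE))) id := rawOfList _
  have h2 : CodeFP (rawE (listE (listE natE))) (rawE (rawE (listE natE))) (fun l => l.map id) :=
    map₀ (rawOfList _)
  have h3 : CodeFP (rawE (rawE (listE natE))) (rawE (rawE (rawE natE)))
      (fun l => l.map fun p => p.map id) := map₀ (map₀ (rawOfList _))
  have hP : CodeFP PEAInst.untypedCode (rawE (rawE (rawE natE))) (fun t => t.2.1) := by
    unfold PEAInst.untypedCode
    exact ((h3.comp (h2.comp h1)).comp (snd _ _).fst').congr fun s => by simp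
  have hk : CodeFP PEAInst.untypedCode natE (fun t => t.2.2) := by
    unfold PEAInst.untypedCode
    exact (snd _ _).snd'
  exact ((codeFP_degOK.comp hP).and
    (natLe.comp ((natAdd.comp (hk.pair (const _ 1))).pair (codeFP_rank.comp hP)))).congr fun _ => rfl

/-! ### Correctness on instances and `PEA 1 ∈ PromiseP` -/

/-- The value of the procedure on (the untyped presentation of) an instance `(n, P, k)`:
`DegLE 1 P ∧ k + 1 ≤ rank_{F₂}` of the linear-part matrix `(#{[j] in Pᵢ} mod 2)ᵢⱼ`.
[DvirGutfreundRothblumVadhan2010, §1 p. 1] -/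
theorem decideFn_untyped_eq_true_iff (I : PEAInst) :
    decideFn (PEAInst.untyped I) = true ↔
      I.2.1.DegLE 1 ∧ I.2.2 + 1 ≤
        (Matrix.of fun (i : Fin I.2.1.length) (j : Fin I.1) =>
          (((I.2.1.get i).count [j] : ℕ) : ZMod 2)).rank := by
  obtain ⟨n, P, k⟩ := I
  simp only [decideFn, PEAInst.untyped_snd_fst, PEAInst.untyped_snd_snd, Bool.and_eq_true,
    decide_eq_true_eq, degOK_untyped_iff, rank_untyped_eq]

/-- **`PEA 1 ∈ PromiseP`: entropy approximation (gap one bit) for sparse AFFINE maps over `F₂` is in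
promise-`P`** — the natural strengthening of thesis X (`PEA 3 ∉ PromiseP`) to degree `1` is false.
Separating language: the strings on which the polynomial-time function of `codeFP_decideFn` answers
`1`; it contains every yes-instance (`k + 1 ≤ H = rank`) and no no-instance (`H = rank ≤ k`).
[DvirGutfreundRothblumVadhan2010, §1 p. 1; Goldreich2006, Def. 1.2] -/
theorem PEA_one_mem_PromiseP : PEA 1 ∈ PromiseP := by
  classical
  obtain ⟨f₀, hf₀, hspec⟩ := codeFP_decideFn
  set g : List Bool → List Bool := HashBricks.headBitFn ∘ f₀ with hg
  have hgFP : g ∈ FP := comp_mem_FP HashBricks.headBitFn_mem_FP hf₀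
  have hval : ∀ I : PEAInst, g (PEAInst.encoding.encode I) = [decideFn (PEAInst.untyped I)] := by
    intro I
    rw [hg, Function.comp_apply, PEAInst.encode_eq_untypedCode, hspec, HashBricks.headBitFn_apply]
    rfl
  set L : Language Bool := {w | g w = [true]} with hLdef
  have hL : L ∈ Classes.P := by
    refine mem_P_of_mem_FP hgFP L fun w => ⟨fun hw => hw, fun hw => ?_⟩
    have hw' : g w ≠ [true] := hw
    have hone : g w = [(f₀ w).headD false] := by
      rw [hg, Function.comp_apply, HashBricks.headBitFn_apply]
    rw [hone] at hw' ⊢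
    cases hb : (f₀ w).headD false
    · rfl
    · rw [hb] at hw'
      exact absurd rfl hw'
  refine ⟨L, hL, ?_, ?_⟩
  · -- yes-instances: `k + 1 ≤ H = rank`, so the procedure accepts
    rintro w ⟨I, hI, rfl⟩
    obtain ⟨hdeg, hH⟩ := hI
    show g (PEAInst.encoding.encode I) = [true]
    rw [hval, (decideFn_untyped_eq_true_iff I).2]
    refine ⟨hdeg, ?_⟩
    rw [PolyMapF2.entropy_eq_rank_of_degLE_one hdeg] at hH
    exact_mod_cast hH
  · -- no-instances: `H = rank ≤ k`, so the procedure rejects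
    rintro w ⟨I, hI, rfl⟩ hw
    obtain ⟨hdeg, hH⟩ := hI
    change g (PEAInst.encoding.encode I) = [true] at hw
    rw [hval] at hw
    have hb : decideFn (PEAInst.untyped I) = true := by simpa using hw
    obtain ⟨-, hk⟩ := (decideFn_untyped_eq_true_iff I).1 hb
    rw [PolyMapF2.entropy_eq_rank_of_degLE_one hdeg] at hH
    have hle := Nat.cast_le.1 hH
    omega

/-! ### Consequences along the degree dial -/

/-- At degree `1` the promise is total: the entropy of an affine map is an integer (`= rank`), so
every degree-`≤ 1` instance is a yes-instance (`k + 1 ≤ H`) or a no-instance (`H ≤ k`) of `PEA 1` —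
the one-bit gap excludes nothing below degree `2`. [DvirGutfreundRothblumVadhan2010, §1 p. 1, §3 p. 6] -/
theorem PEA_one_promise_total (I : PEAInst) (h : I.2.1.DegLE 1) :
    PEAInst.encoding.encode I ∈ (PEA 1).yes ∨ PEAInst.encoding.encode I ∈ (PEA 1).no := by
  rw [encode_mem_PEA_yes_iff, encode_mem_PEA_no_iff, PolyMapF2.entropy_eq_rank_of_degLE_one h]
  set r := (Matrix.of fun (i : Fin I.2.1.length) (j : Fin I.1) =>
    (((I.2.1.get i).count [j] : ℕ) : ZMod 2)).rank
  rcases Nat.lt_or_ge I.2.2 r with hlt | hge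
  · exact Or.inl ⟨h, by exact_mod_cast hlt⟩
  · exact Or.inr ⟨h, by exact_mod_cast hge⟩

/-- Degrees `0` and `1` are easy: `PEA d ∈ PromiseP` for `d ≤ 1` (degree `0` by monotonicity of the
instance sets in `d`, a separator for `PEA 1` separates `PEA 0`). [DvirGutfreundRothblumVadhan2010, §1 p. 1] -/
theorem PEA_mem_PromiseP_of_le_one {d : ℕ} (hd : d ≤ 1) : PEA d ∈ PromiseP := by
  obtain ⟨L, hL, hy, hn⟩ := PEA_one_mem_PromiseP
  exact ⟨L, hL, (PEA_yes_mono hd).trans hy, (PEA_no_mono hd).trans hn⟩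

/-- **Hardness of entropy approximation, if any, starts at degree `2`**: `PEA d ∉ PromiseP` forces
`2 ≤ d`.  So along the degree dial thesis X (`d = 3`) can only be inherited from the quadratic rung
(crux `PeaTwoMemBPP`) or be genuinely cubic. [DvirGutfreundRothblumVadhan2010, §1 p. 1 and §5] -/
theorem two_le_of_PEA_not_mem_PromiseP' {d : ℕ} (h : PEA d ∉ PromiseP) : 2 ≤ d := by
  by_contra hd
  exact h (PEA_mem_PromiseP_of_le_one (by omega))

/-- The strengthening of X to all positive degrees is false. [DvirGutfreundRothblumVadhan2010, §1 p. 1] -/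
theorem not_forall_pos_degree_PEA_not_mem_PromiseP : ¬ (∀ d : ℕ, 1 ≤ d → PEA d ∉ PromiseP) :=
  fun h => h 1 le_rfl PEA_one_mem_PromiseP

end Summit.PneNP.PneNP.Theorems.PeaThreeNotInP.Negative
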